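import Mathlib
import Summits.Ventures.HodgeRepro.Tier4.Line4.TailSeesawDomain
import Summits.Ventures.HodgeRepro.Tier4.Line4.TorusFinSplit

/-!
# Tier4/Line4/TailSeesawDomainHaar — C-L4-7B-HAAR-AWAY: the (7b) display body of `TailSeesawDomain` with the away Haar
measures `νA νA'` CHOSEN INSIDE (`Measure.haar` on `T_f^{(p)}` and `T′_f^{(p)}`)

Blind re-derivation cell `pub-hodge-repro`, Tier 4 «prove the step» (README §9–§10), seat t4-L2-p2 (gen 6; plan-4 g8's cut
S16401 (4), TAKEN S16402).  Tree path `lean/Summits/Ventures/HodgeRepro/Tier4/Line4/TailSeesawDomainHaar.lean`.  Imports this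
seat's `Line4/TailSeesawDomain` (`tailForArch_seesaw_of_ratio_domain'`) and L2-p1's `Line4/TorusFinSplit`
(`locallyCompact_torusFinAway`, `locallyCompact_torusFinAway'`).  Mathlib-level; no literature; no `def`.

**`tailForArch_seesaw_of_ratio_domain'_haar`**: `tailForArch_seesaw_of_ratio_domain'` with the two binders `νA [IsHaar]`,
`νA' [IsHaar]` DELETED and the display's fundamental-domain clause `hfd₀` and (S-FIN-NV) clause `haway` stated at Mathlib's
`Measure.haar` on the locally compact closed subgroups `T_f^{(p)}`, `T′_f^{(p)}` (written `@Measure.haar _ _ _ _ _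
(Subtype.borelSpace _) (locallyCompact_torusFinAway …)`: the two instances the statement needs are theorems of the tree,
not instances, so they are passed explicitly) — every other binder and the conclusion token-identical (the `_haar` /
`_compact` pattern of TailSeesawHaar).
THE RESIDUAL (the (7b) census at this layer): `ht` · the archimedean Haar pair `νinf νinf'` (in the statement) · the level
prime `p hp hγ₀` with (E1)'s `hns` · the print `hZc` · the sign data `hw hcm hα hβ hdef` · the K-type matching `hchi hchi'`
(the display's own) · `DA₀ hfd₀ haway` (the display's one-domain (S-FIN-NV) at the Haar measures).

Nothing here says anything about the status of the Hodge conjecture for CM abelian varieties, which is NOT proved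
(HC_CM is NOT proved by anyone in this repository).
-/

set_option autoImplicit false

noncomputable section

namespace Summit.Ventures.HodgeRepro.Tier4.Line4

open Matrix MeasureTheory Topology Filter NumberField IsDedekindDomain Summit.Ventures.HodgeRepro.Tier4
  Summit.Ventures.HodgeRepro.Tier4.Common Summit.Ventures.HodgeRepro.Tier4.Line1
  Summit.Ventures.HodgeRepro.Tier4.Line1.RTF Summit.Ventures.HodgeRepro.Tier4.Line4.L1Class

open scoped NumberField NNReal ENNReal Pointwise Matrix ComplexConjugate

section DomainHaar

variable {k : Type} [Field k] [NumberField k]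

/-- **The (7b) display body at the plane of record with the away Haar measures by name** (`Measure.haar` on `T_f^{(p)}`,
`T′_f^{(p)}`). -/
theorem tailForArch_seesaw_of_ratio_domain'_haar (q : QuadData k) (ht : q.t = 0) (hn : ¬ IsSquare (-q.n))
    (a : Fin 4 → k) (ha : ∀ i, a i ≠ 0)
    (g g' : Matrix (Fin 4) (Fin 4) k) (hgg' : g * g' = 1) (hg'g : g' * g = 1)
    (hgΩ : g * (PlaneData.mixedRow q (a 0) (a 2)).Ω = (PlaneData.mixedRow q (a 0) (a 2)).Ω * g)
    (lam : k) (hlam : lam ≠ 0)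
    (hiso : g * (PlaneData.mixedRow q (a 1) (a 3)).B * gᵀ = lam • (PlaneData.mixedRow q (a 0) (a 2)).B)
    [MeasurableSpace (GA ((PlaneData.mixedRow q (a 0) (a 2)).withTransportedTorus g g' hgg' hg'g hgΩ))] [BorelSpace (GA ((PlaneData.mixedRow q (a 0) (a 2)).withTransportedTorus g g' hgg' hg'g hgΩ))]
    (R : RTFData ((PlaneData.mixedRow q (a 0) (a 2)).withTransportedTorus g g' hgg' hg'g hgΩ)) (hRH : R.IsHaar)
    (hc : Continuous R.chi) (hu : ∀ a, ‖R.chi a‖ = 1) (hc' : Continuous R.chi') (hu' : ∀ a, ‖R.chi' a‖ = 1)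
    (w₀ : InfinitePlace k) (eP eM eP' eM' : InfinitePlace k → ℤ)
    -- the K-type matching of the display (its own `_hchi` / `_hchi'`), in `D : KTypeData`'s place
    (hchi : ∀ w, ChiMatchesAt ((PlaneData.mixedRow q (a 0) (a 2)).withTransportedTorus g g' hgg' hg'g hgΩ) q w (eP w) (eM w) R.chi)
    (hchi' : ∀ w, ChiMatchesAt' ((PlaneData.mixedRow q (a 0) (a 2)).withTransportedTorus g g' hgg' hg'g hgΩ) q w g g' (eP' w) (eM' w) R.chi')
    [R.μT.IsHaarMeasure] [R.μT'.IsHaarMeasure]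
    (μ : Measure (GA ((PlaneData.mixedRow q (a 0) (a 2)).withTransportedTorus g g' hgg' hg'g hgΩ))) [μ.IsHaarMeasure] (DG : Set (GA ((PlaneData.mixedRow q (a 0) (a 2)).withTransportedTorus g g' hgg' hg'g hgΩ))) (fdG : IsFundamentalDomain (rationalPoints ((PlaneData.mixedRow q (a 0) (a 2)).withTransportedTorus g g' hgg' hg'g hgΩ)) DG μ)
    (compG : IsCompact (closure DG)) (compT : IsCompact (closure R.DT)) (compT' : IsCompact (closure R.DT'))
    (γ₀ : rationalPoints ((PlaneData.mixedRow q (a 0) (a 2)).withTransportedTorus g g' hgg' hg'g hgΩ)) (hlin : IsLinRegular ((PlaneData.mixedRow q (a 0) (a 2)).withTransportedTorus g g' hgg' hg'g hgΩ) γ₀)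
    (νinf : Measure (torusInf ((PlaneData.mixedRow q (a 0) (a 2)).withTransportedTorus g g' hgg' hg'g hgΩ))) [νinf.IsHaarMeasure]
    (νinf' : Measure (torusInf' ((PlaneData.mixedRow q (a 0) (a 2)).withTransportedTorus g g' hgg' hg'g hgΩ))) [νinf'.IsHaarMeasure]
    (p : ℕ) (hp : p.Prime)
    (hγ₀ : ∀ v : HeightOneSpectrum (𝓞 k), natSize k v p < 1 → ∀ i j : Fin 4,
      Valued.v (finPart k (GA.mat ((PlaneData.mixedRow q (a 0) (a 2)).withTransportedTorus g g' hgg' hg'g hgΩ) (γ₀ : GA ((PlaneData.mixedRow q (a 0) (a 2)).withTransportedTorus g g' hgg' hg'g hgΩ)) i j) v) ≤ 1 ∧ Valued.v (finPart k (GA.mat ((PlaneData.mixedRow q (a 0) (a 2)).withTransportedTorus g g' hgg' hg'g hgΩ) (γ₀ : GA ((PlaneData.mixedRow q (a 0) (a 2)).withTransportedTorus g g' hgg' hg'g hgΩ))⁻¹ i j) v) ≤ 1)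
    -- (E1)'s local clause at `p` and ZDOMAIN-EX's cocompactness of `Z(k)` in `Z_f` (AwayDomainRowNonsplit's displayed inputs)
    (hns : ∀ v ∈ placesAbove (k := k) p, ¬ IsSquare (algebraMap k (v.adicCompletion k) (q.t ^ 2 - 4 * q.n)))
    (hZc : ∃ E : Set (torusFin ((PlaneData.mixedRow q (a 0) (a 2)).withTransportedTorus g g' hgg' hg'g hgΩ)), IsCompact E ∧
      E ⊆ (ZfIn ((PlaneData.mixedRow q (a 0) (a 2)).withTransportedTorus g g' hgg' hg'g hgΩ) : Set _) ∧
      (ZfIn ((PlaneData.mixedRow q (a 0) (a 2)).withTransportedTorus g g' hgg' hg'g hgΩ) : Set _) ⊆ (centreFin ((PlaneData.mixedRow q (a 0) (a 2)).withTransportedTorus g g' hgg' hg'g hgΩ) : Set _) * E)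
    -- (the away Haar measures are `Measure.haar`; the product `Z(k)`-domain of record is drawn inside from `hns`, `hZc`
    -- and the CM clauses)
    -- (S-FIN-NV)'s display at ONE `centreAway`-fundamental domain `DA₀` of the display's choice (the product domain of
    -- record is DRAWN inside: AwayDomainRowNonsplit; `haway` transfers to it by AwayOrbitalDomain)
    (DA₀ : Set (torusFinAway ((PlaneData.mixedRow q (a 0) (a 2)).withTransportedTorus g g' hgg' hg'g hgΩ) (placesAbove (k := k) p)))
    (hfd₀ : IsFundamentalDomain (centreAway ((PlaneData.mixedRow q (a 0) (a 2)).withTransportedTorus g g' hgg' hg'g hgΩ) (placesAbove (k := k) p)) DA₀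
      (@MeasureTheory.Measure.haar (torusFinAway ((PlaneData.mixedRow q (a 0) (a 2)).withTransportedTorus g g' hgg' hg'g hgΩ) (placesAbove (k := k) p)) _ _ _ _ (Subtype.borelSpace _)
        (locallyCompact_torusFinAway ((PlaneData.mixedRow q (a 0) (a 2)).withTransportedTorus g g' hgg' hg'g hgΩ) (placesAbove (k := k) p))))
    (haway : awayOrbital ((PlaneData.mixedRow q (a 0) (a 2)).withTransportedTorus g g' hgg' hg'g hgΩ) (placesAbove (k := k) p) R (γ₀ : GA ((PlaneData.mixedRow q (a 0) (a 2)).withTransportedTorus g g' hgg' hg'g hgΩ))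
      (@MeasureTheory.Measure.haar (torusFinAway ((PlaneData.mixedRow q (a 0) (a 2)).withTransportedTorus g g' hgg' hg'g hgΩ) (placesAbove (k := k) p)) _ _ _ _ (Subtype.borelSpace _)
        (locallyCompact_torusFinAway ((PlaneData.mixedRow q (a 0) (a 2)).withTransportedTorus g g' hgg' hg'g hgΩ) (placesAbove (k := k) p)))
      (@MeasureTheory.Measure.haar (torusFinAway' ((PlaneData.mixedRow q (a 0) (a 2)).withTransportedTorus g g' hgg' hg'g hgΩ) (placesAbove (k := k) p)) _ _ _ _ (Subtype.borelSpace _)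
        (locallyCompact_torusFinAway' ((PlaneData.mixedRow q (a 0) (a 2)).withTransportedTorus g g' hgg' hg'g hgΩ) (placesAbove (k := k) p))) DA₀ ≠ 0)
    -- (S-COUNT) BY NAME: the sign data of display (8) in `hcount`'s place — `w₀` (already bound: the indefinite place of
    -- `IsArchCoeffD`) real and CM, the `(1,1)` signs `hα hβ` at `w₀`, and the ONE displayed definiteness clause `hdef`
    (hw : w₀.IsReal) (hcm : IsCMAt q w₀) (hα : 0 < alphaLoc (a 0) hw) (hβ : betaLoc (a 2) (-1) hw < 0)
    (hdef : SeesawDefinite q a w₀) :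
    ∀ finf : GA ((PlaneData.mixedRow q (a 0) (a 2)).withTransportedTorus g g' hgg' hg'g hgΩ) → ℂ,
      IsArchCoeffD ((PlaneData.mixedRow q (a 0) (a 2)).withTransportedTorus g g' hgg' hg'g hgΩ) (Setting.ofAdelicData ((PlaneData.mixedRow q (a 0) (a 2)).withTransportedTorus g g' hgg' hg'g hgΩ) R μ DG fdG compG compT compT') R q g g' w₀ eP eM eP' eM'
        (γ₀ : GA ((PlaneData.mixedRow q (a 0) (a 2)).withTransportedTorus g g' hgg' hg'g hgΩ)) νinf νinf' finf →
      ∃ lev : ℕ → ℕ, (∀ n, lev n ≠ 0) ∧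
      ∃ ffin f₂ : ℕ → GA ((PlaneData.mixedRow q (a 0) (a 2)).withTransportedTorus g g' hgg' hg'g hgΩ) → ℂ, TailFamily' ((PlaneData.mixedRow q (a 0) (a 2)).withTransportedTorus g g' hgg' hg'g hgΩ) q g g' eP' eM' (γ₀ : GA ((PlaneData.mixedRow q (a 0) (a 2)).withTransportedTorus g g' hgg' hg'g hgΩ)) ffin f₂ ∧
        ∃ E : Finset (Setting.ofAdelicData ((PlaneData.mixedRow q (a 0) (a 2)).withTransportedTorus g g' hgg' hg'g hgΩ) R μ DG fdG compG compT compT').Orbit,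
          (Setting.ofAdelicData ((PlaneData.mixedRow q (a 0) (a 2)).withTransportedTorus g g' hgg' hg'g hgΩ) R μ DG fdG compG compT compT').orbitOf γ₀ ∈ E ∧
          FibreDominatedFrom (Setting.ofAdelicData ((PlaneData.mixedRow q (a 0) (a 2)).withTransportedTorus g g' hgg' hg'g hgΩ) R μ DG fdG compG compT compT') R.chi R.chi' E
            (fun n => (Setting.ofAdelicData ((PlaneData.mixedRow q (a 0) (a 2)).withTransportedTorus g g' hgg' hg'g hgΩ) R μ DG fdG compG compT compT').conv
              (prodFn ((PlaneData.mixedRow q (a 0) (a 2)).withTransportedTorus g g' hgg' hg'g hgΩ) finf (ffin (lev n))) (f₂ (lev n))) := by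
  haveI := locallyCompact_torusFinAway ((PlaneData.mixedRow q (a 0) (a 2)).withTransportedTorus g g' hgg' hg'g hgΩ) (placesAbove (k := k) p)
  haveI := locallyCompact_torusFinAway' ((PlaneData.mixedRow q (a 0) (a 2)).withTransportedTorus g g' hgg' hg'g hgΩ) (placesAbove (k := k) p)
  haveI : BorelSpace (torusT ((PlaneData.mixedRow q (a 0) (a 2)).withTransportedTorus g g' hgg' hg'g hgΩ)) := Subtype.borelSpace _
  haveI : BorelSpace (torusFin ((PlaneData.mixedRow q (a 0) (a 2)).withTransportedTorus g g' hgg' hg'g hgΩ)) := Subtype.borelSpace _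
  haveI : BorelSpace (torusFinAway ((PlaneData.mixedRow q (a 0) (a 2)).withTransportedTorus g g' hgg' hg'g hgΩ) (placesAbove (k := k) p)) := Subtype.borelSpace _
  haveI : BorelSpace (torusT' ((PlaneData.mixedRow q (a 0) (a 2)).withTransportedTorus g g' hgg' hg'g hgΩ)) := Subtype.borelSpace _
  haveI : BorelSpace (torusFin' ((PlaneData.mixedRow q (a 0) (a 2)).withTransportedTorus g g' hgg' hg'g hgΩ)) := Subtype.borelSpace _
  haveI : BorelSpace (torusFinAway' ((PlaneData.mixedRow q (a 0) (a 2)).withTransportedTorus g g' hgg' hg'g hgΩ) (placesAbove (k := k) p)) := Subtype.borelSpace _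
  exact tailForArch_seesaw_of_ratio_domain' q ht hn a ha g g' hgg' hg'g hgΩ lam hlam hiso R hRH hc hu hc' hu' w₀ eP eM eP'
    eM' hchi hchi' μ DG fdG compG compT compT' γ₀ hlin νinf νinf' p hp hγ₀ hns hZc _ _ DA₀ hfd₀ haway hw hcm hα hβ hdef

end DomainHaar

end Summit.Ventures.HodgeRepro.Tier4.Line4

end
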